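import Mathlib
import Literature.Analysis.FunctionSpaces.TorusCalculus
import Literature.Analysis.FunctionSpaces.FlatTorusProofs
import Literature.Analysis.FunctionSpaces.HolderNormTorusProofs

/-!
# Thin-set Liouville lemma, part B: smooth cut-offs with `|∇χ_r| ≤ 1/r`

Support file for stmt-AnomalousDissipation-1049 (`SteadyNegTameOffThinSets`) via the thin-set
Liouville lemma (stmt-AnomalousDissipation-1047). Given a `1`-Lipschitz function `δ` on `T^d`
(in the application: the distance to a closed set `S`) and `r > 0`, we produce a SMOOTH
`χ : T^d → [0, 1]` with `χ = 0` on `{δ < r/2}`, `χ = 1` on `{5r/2 < δ}`, `‖Dχ‖ ≤ r⁻¹`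
everywhere and `Dχ = 0` on `{3r ≤ δ}` (`exists_smooth_cutoff`). No new definitions are
introduced: the construction lives inside the proof. It mollifies the lift of the
`r⁻¹`-Lipschitz function `min 1 (max 0 (δ/r - 1))` with Mathlib's normed bump of outer radius
`r/2` (`MeasureTheory.convolution`, `ContDiffBump.normed`); mollification by a probability
kernel preserves Lipschitz constants, the range `[0,1]` and lattice periodicity
(`lipschitzWith_normed_convolution`, `normed_convolution_mem_Icc`,
`isLatticePeriodic_normed_convolution`), is smooth (`HasCompactSupport.contDiff_convolution_left`)
and reproduces locally constant values (`ContDiffBump.normed_convolution_eq_right`); the gradient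
bound is `norm_fderiv_le_of_lipschitz`, and the periodic smooth function descends to the torus
(`Torus.descend`, `Torus.lift_descend_holds`). Folklore (first-order regularised distance,
cf. Stein, Singular Integrals, Ch. VI §2).
-/

set_option linter.dupNamespace false  -- `Summit.AnomalousDissipation.AnomalousDissipation` is the mandated summit/problem namespace

noncomputable section

open MeasureTheory Metric Filter Topology Set Function
open scoped Convolution NNReal ContDiff
open Literature.Analysis.FunctionSpaces Literature.Analysis.FunctionSpaces.Torus

namespace Summit.AnomalousDissipation.AnomalousDissipation.Theorems.ThinSetLiouville

variable {d : Type*} [Fintype d]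

/-! ## Mollification by a normed bump on `ℝ^d` -/

section Mollify

variable (φ : ContDiffBump (0 : EuclideanSpace ℝ d))

/-- The mollification as an integral: `(φ̄ ⋆ ψ)(x) = ∫ φ̄(t) ψ(x - t) dt`. [folklore] -/
theorem normed_convolution_apply (ψ : EuclideanSpace ℝ d → ℝ) (x : EuclideanSpace ℝ d) :
    (φ.normed volume ⋆[ContinuousLinearMap.lsmul ℝ ℝ, volume] ψ) x =
      ∫ t, φ.normed volume t * ψ (x - t) := by
  rw [convolution_lsmul]
  rfl

/-- The integrand of the mollification is integrable. [folklore] -/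
theorem integrable_normed_mul {ψ : EuclideanSpace ℝ d → ℝ} (hψ : Continuous ψ)
    (x : EuclideanSpace ℝ d) : Integrable (fun t => φ.normed volume t * ψ (x - t)) volume :=
  (φ.continuous_normed.mul (hψ.comp (continuous_const.sub continuous_id))).integrable_of_hasCompactSupport
    φ.hasCompactSupport_normed.mul_right

/-- Mollification by a probability kernel preserves Lipschitz constants. [folklore] -/
theorem lipschitzWith_normed_convolution {ψ : EuclideanSpace ℝ d → ℝ} (hψc : Continuous ψ) {K : ℝ≥0}
    (hψ : LipschitzWith K ψ) :
    LipschitzWith K (φ.normed volume ⋆[ContinuousLinearMap.lsmul ℝ ℝ, volume] ψ) := by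
  refine LipschitzWith.of_dist_le_mul fun x y => ?_
  rw [normed_convolution_apply, normed_convolution_apply, dist_eq_norm,
    ← integral_sub (integrable_normed_mul φ hψc x) (integrable_normed_mul φ hψc y)]
  calc ‖∫ t, (φ.normed volume t * ψ (x - t) - φ.normed volume t * ψ (y - t))‖
      ≤ ∫ t, ‖φ.normed volume t * ψ (x - t) - φ.normed volume t * ψ (y - t)‖ :=
        norm_integral_le_integral_norm _
    _ ≤ ∫ t, φ.normed volume t * (K * dist x y) := by
        refine integral_mono ((integrable_normed_mul φ hψc x).sub
          (integrable_normed_mul φ hψc y)).norm (φ.integrable_normed.mul_const _) fun t => ?_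
        simp only
        rw [← mul_sub, norm_mul, Real.norm_of_nonneg (φ.nonneg_normed t), ← dist_eq_norm]
        refine mul_le_mul_of_nonneg_left ?_ (φ.nonneg_normed t)
        have h := hψ.dist_le_mul (x - t) (y - t)
        rwa [dist_sub_right] at h
    _ = K * dist x y := by
        rw [integral_mul_const, φ.integral_normed, one_mul]

/-- Mollification by a probability kernel preserves the range `[0, 1]`. [folklore] -/
theorem normed_convolution_mem_Icc {ψ : EuclideanSpace ℝ d → ℝ} (hψc : Continuous ψ)
    (h0 : ∀ x, 0 ≤ ψ x) (h1 : ∀ x, ψ x ≤ 1) (x : EuclideanSpace ℝ d) :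
    (φ.normed volume ⋆[ContinuousLinearMap.lsmul ℝ ℝ, volume] ψ) x ∈ Icc (0 : ℝ) 1 := by
  rw [normed_convolution_apply]
  refine ⟨integral_nonneg fun t => mul_nonneg (φ.nonneg_normed t) (h0 _), ?_⟩
  calc ∫ t, φ.normed volume t * ψ (x - t) ≤ ∫ t, φ.normed volume t := by
        refine integral_mono (integrable_normed_mul φ hψc x) φ.integrable_normed fun t => ?_
        simpa using mul_le_mul_of_nonneg_left (h1 (x - t)) (φ.nonneg_normed t)
    _ = 1 := φ.integral_normed

/-- Mollification preserves lattice periodicity. [folklore] -/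
theorem isLatticePeriodic_normed_convolution [DecidableEq d] {ψ : EuclideanSpace ℝ d → ℝ}
    (hψ : IsLatticePeriodic ψ) :
    IsLatticePeriodic (φ.normed volume ⋆[ContinuousLinearMap.lsmul ℝ ℝ, volume] ψ) := by
  intro j x
  rw [normed_convolution_apply, normed_convolution_apply]
  congr 1
  funext t
  rw [show x + EuclideanSpace.single j 1 - t = (x - t) + EuclideanSpace.single j 1 by abel, hψ j]

end Mollify

/-! ## The smooth cut-off -/

/-- **Smooth cut-offs adapted to a `1`-Lipschitz function.** For `δ : T^d → ℝ` `1`-Lipschitz and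
`r > 0` there is a smooth `χ : T^d → [0,1]` with `χ = 0` on `{δ < r/2}`, `χ = 1` on
`{5r/2 < δ}`, `‖Dχ‖ ≤ r⁻¹` everywhere and `Dχ = 0` on `{3r ≤ δ}` (mollify the lift of
`min 1 (max 0 (δ/r - 1))` at scale `r/2` and descend). [folklore] -/
theorem exists_smooth_cutoff [DecidableEq d] (δ : UnitAddTorus d → ℝ) (hδ : LipschitzWith 1 δ)
    {r : ℝ} (hr : 0 < r) :
    ∃ χ : UnitAddTorus d → ℝ, IsSmooth χ ∧ (∀ x, 0 ≤ χ x ∧ χ x ≤ 1) ∧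
      (∀ x, δ x < r / 2 → χ x = 0) ∧ (∀ x, 5 * r / 2 < δ x → χ x = 1) ∧
      (∀ x, ‖Torus.fderiv χ x‖ ≤ r⁻¹) ∧ (∀ x, 3 * r ≤ δ x → Torus.fderiv χ x = 0) := by
  -- the raw Lipschitz cut-off on the torus and its lift
  set ρ : UnitAddTorus d → ℝ := fun x => min 1 (max 0 (δ x / r - 1)) with hρ_def
  have hρc : Continuous ρ :=
    continuous_const.min (continuous_const.max ((hδ.continuous.div_const r).sub continuous_const))
  have hρ0 : ∀ x, 0 ≤ ρ x := fun x => le_min zero_le_one (le_max_left _ _)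
  have hρ1 : ∀ x, ρ x ≤ 1 := fun x => min_le_left _ _
  have hρ_zero : ∀ x, δ x ≤ r → ρ x = 0 := fun x hx => by
    have h : δ x / r - 1 ≤ 0 := by rw [sub_nonpos, div_le_one hr]; exact hx
    simp only [hρ_def]
    rw [max_eq_left h, min_eq_right zero_le_one]
  have hρ_one : ∀ x, 2 * r ≤ δ x → ρ x = 1 := fun x hx => by
    have h : 1 ≤ δ x / r - 1 := by
      rw [le_sub_iff_add_le, le_div_iff₀ hr]; linarith
    simp only [hρ_def]
    rw [max_eq_right (zero_le_one.trans h), min_eq_left h]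
  have hδproj : ∀ y y' : EuclideanSpace ℝ d, dist (δ (proj y)) (δ (proj y')) ≤ dist y y' := by
    intro y y'
    have h := hδ.dist_le_mul (proj y) (proj y')
    rw [NNReal.coe_one, one_mul] at h
    exact h.trans ((lipschitzWith_proj.dist_le_mul y y').trans (by simp))
  have hlipρ : LipschitzWith (Real.toNNReal r⁻¹) (lift ρ) := by
    have h1 : LipschitzWith (Real.toNNReal r⁻¹) (fun y : EuclideanSpace ℝ d => δ (proj y) / r - 1) := by
      refine LipschitzWith.of_dist_le_mul fun y y' => ?_
      rw [Real.coe_toNNReal _ (inv_nonneg.2 hr.le), dist_eq_norm, Real.norm_eq_abs,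
        show δ (proj y) / r - 1 - (δ (proj y') / r - 1) = r⁻¹ * (δ (proj y) - δ (proj y')) by ring,
        abs_mul, abs_of_pos (inv_pos.2 hr)]
      refine mul_le_mul_of_nonneg_left ?_ (inv_nonneg.2 hr.le)
      have h := hδproj y y'
      rwa [Real.dist_eq] at h
    exact (h1.const_max 0).const_min 1
  have hcρ : Continuous (lift ρ) := continuous_lift_iff.2 hρc
  -- the mollifier and the lifted smooth cut-off
  set φ : ContDiffBump (0 : EuclideanSpace ℝ d) := ⟨r / 4, r / 2, by positivity, by linarith⟩ with hφ_def
  set χl : EuclideanSpace ℝ d → ℝ := φ.normed volume ⋆[ContinuousLinearMap.lsmul ℝ ℝ, volume] lift ρ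
    with hχl_def
  have hχl_smooth : ContDiff ℝ ∞ χl :=
    φ.hasCompactSupport_normed.contDiff_convolution_left _ φ.contDiff_normed hcρ.locallyIntegrable
  have hχl_per : IsLatticePeriodic χl := isLatticePeriodic_normed_convolution φ (isLatticePeriodic_lift ρ)
  have hχl_Icc : ∀ y, χl y ∈ Icc (0 : ℝ) 1 := fun y =>
    normed_convolution_mem_Icc φ hcρ (fun _ => hρ0 _) (fun _ => hρ1 _) y
  have hχl_fderiv : ∀ y, ‖fderiv ℝ χl y‖ ≤ r⁻¹ := fun y => by
    have h := norm_fderiv_le_of_lipschitz ℝ (lipschitzWith_normed_convolution φ hcρ hlipρ) (x₀ := y)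
    rwa [Real.coe_toNNReal _ (inv_nonneg.2 hr.le)] at h
  -- local constancy near `{δ < r/2}` and `{5r/2 < δ}`
  have hχl_zero : ∀ y, δ (proj y) < r / 2 → χl y = 0 := by
    intro y hy
    have h0 : lift ρ y = 0 := hρ_zero _ (by linarith)
    have hball : ∀ z ∈ ball y φ.rOut, lift ρ z = lift ρ y := by
      intro z hz
      rw [h0, lift_apply]
      refine hρ_zero _ ?_
      have h1 := hδproj z y
      rw [Real.dist_eq] at h1
      have h2 : dist z y < r / 2 := hz
      have h3 := (abs_sub_lt_iff.1 (h1.trans_lt h2)).1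
      linarith
    rw [hχl_def, φ.normed_convolution_eq_right hball, h0]
  have hχl_one : ∀ y, 5 * r / 2 < δ (proj y) → χl y = 1 := by
    intro y hy
    have h0 : lift ρ y = 1 := hρ_one _ (by linarith)
    have hball : ∀ z ∈ ball y φ.rOut, lift ρ z = lift ρ y := by
      intro z hz
      rw [h0, lift_apply]
      refine hρ_one _ ?_
      have h1 := hδproj z y
      rw [Real.dist_eq] at h1
      have h2 : dist z y < r / 2 := hz
      have h3 := (abs_sub_lt_iff.1 (h1.trans_lt h2)).2
      linarith
    rw [hχl_def, φ.normed_convolution_eq_right hball, h0]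
  have hχl_fderiv_zero : ∀ y, 5 * r / 2 < δ (proj y) → fderiv ℝ χl y = 0 := by
    intro y hy
    have hev : χl =ᶠ[𝓝 y] fun _ => 1 := by
      have ho : IsOpen {z : EuclideanSpace ℝ d | 5 * r / 2 < δ (proj z)} :=
        isOpen_lt continuous_const (hδ.continuous.comp continuous_proj)
      filter_upwards [ho.mem_nhds hy] with z hz
      exact hχl_one z hz
    rw [hev.fderiv_eq, fderiv_const_apply]
  -- descend to the torus
  refine ⟨descend χl hχl_per, ?_, ?_, ?_, ?_, ?_, ?_⟩
  · show ContDiff ℝ ∞ (lift (descend χl hχl_per))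
    rw [lift_descend_holds]
    exact hχl_smooth
  · intro x
    rw [descend_apply]
    exact hχl_Icc _
  · intro x hx
    rw [descend_apply]
    exact hχl_zero _ (by rwa [proj_repr])
  · intro x hx
    rw [descend_apply]
    exact hχl_one _ (by rwa [proj_repr])
  · intro x
    obtain ⟨y, rfl⟩ := proj_surjective x
    rw [← fderiv_lift, lift_descend_holds]
    exact hχl_fderiv y
  · intro x hx
    obtain ⟨y, rfl⟩ := proj_surjective x
    rw [← fderiv_lift, lift_descend_holds]
    exact hχl_fderiv_zero y (by linarith)

end Summit.AnomalousDissipation.AnomalousDissipation.Theorems.ThinSetLiouville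

end
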